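import Summits.QuantumFields.QCD.Theses.FourMirrorsWardE1
import HarnessLib

/-!
# Route `FourMirrorsWardE1` (QCD): the support item `MatrixTwoExpKernel` (stmt-QuantumFields-8843)

ENGINE OF THE TWO-POLE MECHANISM (matrix Källén–Lehmann atoms): for Hermitian `A, B ∈ M_d(ℂ)` and two distinct rates
`0 < ζ₁ ≠ ζ₂`, the block Hankel kernel `(k,k') ↦ ζ₁^{k+k'}A + ζ₂^{k+k'}B` on exponents `k, k' ≥ 1` is of positive type
iff `A ≥ 0` and `B ≥ 0`.

* (⇐) the GRAM IDENTITY `∑ᵢⱼ cᵢ*(ζ₁^{kᵢ+kⱼ}A + ζ₂^{kᵢ+kⱼ}B)cⱼ = u₁*Au₁ + u₂*Bu₂` with `u_m = ∑ᵢ ζ_m^{kᵢ}cᵢ`;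
* (⇒) the witness `N = 2`, `k = (1,2)`, `c = (ζ₂v, −v)` kills the `B`-square (`u₂ = 0`, `u₁ = ζ₁(ζ₂ − ζ₁)v`) and leaves
  `ζ₁²(ζ₂−ζ₁)² · v*Av ≥ 0`; symmetrically for `B`.

Hermiticity is not used.  Finite-dimensional linear algebra over Mathlib; nothing is asserted about QCD; no summit, leg or
crux statement is proved (width seat ym-t4-w17 g0, free hands; the item carried an unlanded candidate proof of 2026-08-16
by refuter g44-14, unreadable from this seat — re-derived here).
-/

set_option autoImplicit false

namespace Summit.QuantumFields.QCD.Theorems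

namespace MatrixTwoExpKernel

open Matrix

variable {d N : ℕ}

/-- The sesquilinear form `Φ_M(x,y) = x* · (M y)` is additive and conjugate-homogeneous in `x`, additive and homogeneous
in `y`; here: the **Gram identity** for one weight vector,
`∑ᵢ∑ⱼ (star wᵢ · wⱼ) · Φ_M(cᵢ,cⱼ) = Φ_M(∑ wᵢcᵢ, ∑ wⱼcⱼ)`. [folklore] -/
theorem gram_identity (M : Matrix (Fin d) (Fin d) ℂ) (w : Fin N → ℂ) (c : Fin N → Fin d → ℂ) :
    ∑ i, ∑ j, star (w i) * w j * (star (c i) ⬝ᵥ M.mulVec (c j))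
      = star (∑ i, w i • c i) ⬝ᵥ M.mulVec (∑ j, w j • c j) := by
  rw [star_sum, sum_dotProduct]
  refine Finset.sum_congr rfl fun i _ => ?_
  rw [Matrix.mulVec_sum, dotProduct_sum]
  refine Finset.sum_congr rfl fun j _ => ?_
  rw [star_smul, Matrix.mulVec_smul, smul_dotProduct, dotProduct_smul, smul_eq_mul, smul_eq_mul]
  ring

/-- The kernel form as a sum of two Gram forms:
`∑ᵢⱼ cᵢ*((ζ₁^{kᵢ+kⱼ})A + (ζ₂^{kᵢ+kⱼ})B)cⱼ = u₁*Au₁ + u₂*Bu₂`, `u_m = ∑ᵢ ζ_m^{kᵢ} cᵢ`, for REAL rates. [folklore] -/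
theorem kernel_eq_gram (A B : Matrix (Fin d) (Fin d) ℂ) (ζ₁ ζ₂ : ℝ) (k : Fin N → ℕ) (c : Fin N → Fin d → ℂ) :
    ∑ i, ∑ j, star (c i) ⬝ᵥ (((ζ₁ : ℂ) ^ (k i + k j) • A + (ζ₂ : ℂ) ^ (k i + k j) • B).mulVec (c j))
      = star (∑ i, ((ζ₁ : ℂ) ^ k i) • c i) ⬝ᵥ A.mulVec (∑ j, ((ζ₁ : ℂ) ^ k j) • c j)
        + star (∑ i, ((ζ₂ : ℂ) ^ k i) • c i) ⬝ᵥ B.mulVec (∑ j, ((ζ₂ : ℂ) ^ k j) • c j) := by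
  rw [← gram_identity, ← gram_identity, ← Finset.sum_add_distrib]
  refine Finset.sum_congr rfl fun i _ => ?_
  rw [← Finset.sum_add_distrib]
  refine Finset.sum_congr rfl fun j _ => ?_
  have hs : ∀ (ζ : ℝ) (n : ℕ), star ((ζ : ℂ) ^ n) = (ζ : ℂ) ^ n := fun ζ n => by
    rw [← Complex.ofReal_pow, Complex.star_def, Complex.conj_ofReal]
  rw [Matrix.add_mulVec, dotProduct_add, Matrix.smul_mulVec, Matrix.smul_mulVec, dotProduct_smul, dotProduct_smul,
    smul_eq_mul, smul_eq_mul, hs, hs, pow_add, pow_add]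

/-- The real part of `v* M v` scales quadratically under a real scalar: `Re((a v)* M (a v)) = a² · Re(v* M v)`. [folklore] -/
theorem re_form_smul (M : Matrix (Fin d) (Fin d) ℂ) (a : ℝ) (v : Fin d → ℂ) :
    (star ((a : ℂ) • v) ⬝ᵥ M.mulVec ((a : ℂ) • v)).re = a ^ 2 * (star v ⬝ᵥ M.mulVec v).re := by
  rw [star_smul, Matrix.mulVec_smul, smul_dotProduct, dotProduct_smul, smul_eq_mul, smul_eq_mul,
    Complex.star_def, Complex.conj_ofReal, ← mul_assoc, ← Complex.ofReal_mul, Complex.re_ofReal_mul]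
  ring

end MatrixTwoExpKernel

open MatrixTwoExpKernel in
/-- **The two-pole Hankel kernel is of positive type iff both residues are positive semi-definite.** [folklore] -/
theorem matrixTwoExpKernel_iff (d : ℕ) (A B : Matrix (Fin d) (Fin d) ℂ) (ζ₁ ζ₂ : ℝ)
    (h₁ : 0 < ζ₁) (h₂ : 0 < ζ₂) (hne : ζ₁ ≠ ζ₂) :
    (∀ (N : ℕ) (k : Fin N → ℕ) (c : Fin N → Fin d → ℂ), (∀ i, 0 < k i) →
        0 ≤ (∑ i, ∑ j, star (c i) ⬝ᵥ (((ζ₁ : ℂ) ^ (k i + k j) • A + (ζ₂ : ℂ) ^ (k i + k j) • B).mulVec (c j))).re)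
      ↔ ((∀ v : Fin d → ℂ, 0 ≤ (star v ⬝ᵥ A.mulVec v).re) ∧ (∀ v : Fin d → ℂ, 0 ≤ (star v ⬝ᵥ B.mulVec v).re)) := by
  constructor
  · intro hK
    -- the witnesses `k = (1,2)`, `c = (ζ' v, −v)`
    have key : ∀ (M M' : Matrix (Fin d) (Fin d) ℂ) (ζ ζ' : ℝ), 0 < ζ → ζ ≠ ζ' →
        (∀ (N : ℕ) (k : Fin N → ℕ) (c : Fin N → Fin d → ℂ), (∀ i, 0 < k i) →
          0 ≤ (∑ i, ∑ j, star (c i) ⬝ᵥ (((ζ : ℂ) ^ (k i + k j) • M + (ζ' : ℂ) ^ (k i + k j) • M').mulVec (c j))).re) →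
        ∀ v : Fin d → ℂ, 0 ≤ (star v ⬝ᵥ M.mulVec v).re := by
      intro M M' ζ ζ' hζ hζζ' hK v
      have h := hK 2 ![1, 2] ![(ζ' : ℂ) • v, -v] (fun i => by fin_cases i <;> simp)
      rw [kernel_eq_gram] at h
      -- `u' = ζ'·ζ' v − ζ'² v = 0`, `u = ζ ζ' v − ζ² v = (ζ(ζ'−ζ)) v`
      have hu' : ∑ i : Fin 2, ((ζ' : ℂ) ^ (![1, 2] : Fin 2 → ℕ) i) • (![(ζ' : ℂ) • v, -v] : Fin 2 → Fin d → ℂ) i = 0 := by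
        rw [Fin.sum_univ_two]
        simp only [Matrix.cons_val_zero, Matrix.cons_val_one, pow_one, smul_smul, smul_neg]
        rw [← sq, add_neg_eq_zero]
      have hu : ∑ i : Fin 2, ((ζ : ℂ) ^ (![1, 2] : Fin 2 → ℕ) i) • (![(ζ' : ℂ) • v, -v] : Fin 2 → Fin d → ℂ) i
          = ((ζ * (ζ' - ζ) : ℝ) : ℂ) • v := by
        rw [Fin.sum_univ_two]
        simp only [Matrix.cons_val_zero, Matrix.cons_val_one, pow_one, smul_smul, smul_neg,
          Complex.ofReal_mul, Complex.ofReal_sub]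
        rw [← sub_eq_add_neg, ← sub_smul]
        ring_nf
      rw [hu', hu, Matrix.mulVec_zero, dotProduct_zero, add_zero, re_form_smul] at h
      have hpos : 0 < (ζ * (ζ' - ζ)) ^ 2 := by
        have : ζ * (ζ' - ζ) ≠ 0 := mul_ne_zero hζ.ne' (sub_ne_zero.mpr (Ne.symm hζζ'))
        positivity
      exact (mul_nonneg_iff_of_pos_left hpos).mp h
    refine ⟨key A B ζ₁ ζ₂ h₁ hne hK, key B A ζ₂ ζ₁ h₂ hne.symm fun N k c hk => ?_⟩
    have := hK N k c hk
    simpa only [add_comm] using this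
  · rintro ⟨hA, hB⟩ N k c _
    rw [kernel_eq_gram, Complex.add_re]
    exact add_nonneg (hA _) (hB _)

/-- **Item stmt-QuantumFields-8843 `FourMirrorsWardE1.MatrixTwoExpKernel` holds.** [folklore] -/
theorem fourMirrorsWardE1_matrixTwoExpKernel_proof :
    Summit.QuantumFields.QCD.Theses.FourMirrorsWardE1.MatrixTwoExpKernel := by
  unfold Summit.QuantumFields.QCD.Theses.FourMirrorsWardE1.MatrixTwoExpKernel
  intro d A B ζ₁ ζ₂ _ _ h₁ h₂ hne
  exact matrixTwoExpKernel_iff d A B ζ₁ ζ₂ h₁ h₂ hne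

end Summit.QuantumFields.QCD.Theorems
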